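import Summits.QuantumFields.YangMills.Theorems.BalabanUVNodesN20BlockCaricatureTVOrderBulk

/-!
# BalabanUVNodes ∕ N20·N19′·N21 — THE EXACT CRITERION OF K3 STUB 2's FACE TRIPLE ON THE CARICATURE, IN CLOSED FORM (FILE K of the caricature series):
# the dials exist ⟺ `Σ_K min(1, n_K|q_K − p_K| ∕ max(1, √(n_K·max(p_K(1−p_K), q_K(1−q_K))))) < ∞`; with RARE blocks (`σ_K ≤ 1`) this is the COUNT letter `Σ_K n_K|q_K − p_K| < ∞`,
# in the BULK (`σ_K ≥ 1`) it is exactly CRIT-1's `Σ_K √Λ_K < ∞` — the `Λ ∕ √Λ` squeeze of MY FILES C∕D∕G is CLOSED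

Cell `pub-ymgap` (HUMAN RULING D-0062 Track A; work-bound push D-0149, director-ym №197), width seat `pub-ymgap-dag-n20-w1` (gen 6) on node N20 = NE7b; key item K3⁸
`SpineGivenEndpointR13SepCoPHV` = stmt-QuantumFields-27366 (dag-lead KEY MAP v2, INBOX l.35754: `--kind proof --supports 27366 --as helper`; lineage key K3⁷ stmt-QuantumFields-20544, whose
skeleton v5 941dddb108cbaacf and evidence stay as the aside — MY FILES A–J were keyed there and are lineage BY NAME); COUNT-NEUTRAL.  Bus: CLAIM-15 ∕ INTENT-20c (INBOX l.35172 ∕ l.35427).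
THEOREMS ONLY: no `def`, no `instance`, no `notation`, no `sorry`; imports MY FILE J `…N20BlockCaricatureTVOrderBulk` only (through it FILES F∕H∕I and n19-w2's p615382).

WHY.  MY g5 series left the caricature's verdict between two STRICT brackets (FILE C: `Σ Λ_K < ∞` necessary, `Σ √Λ_K < ∞` sufficient; FILE G: both strict), so a record reading of
`(n_K, p_K, q_K)` (LOCATED sentence 6 of `N20-W1-G5-LOCATED.md`) could still land in the gap.  With the ORDER of the count ℓ¹ (FILES I∕J) the verdict is a CLOSED FORM: summable
«expected number of discrepant level-1 blocks, in units of max(1, the larger count standard deviation)».  The two strictness witnesses of FILE G are the two regimes of this formula.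
* §1 [folklore] `summable_min_one_iff` (`Σ min(1,x_K) < ∞ ⟺ Σ x_K < ∞`, `x ≥ 0`) · `summable_iff_of_order`.
* §2 [folklore ∕ bookkeeping] ★★ `summable_l1Count_iff_summable_closedForm` · ★★★★ `exists_hybridNE7_caricature_iff_summable_closedForm` ((∃ Bad W shA shB Wsh δ, `HybridNE7` on the
  caricature carriers) ⟺ the closed form; MY FILE F + FILE J `l1Count_order`) · ★★ `faces_caricature_iff_summable_closedForm` (stub 2's own conjunct shape).
* §3 [folklore ∕ bookkeeping] ★★ `summable_closedForm_iff_summable_meanShift_of_rare` ∕ ★★★ `exists_hybridNE7_caricature_iff_summable_meanShift_of_rare` (`σ_K ≤ 1` for all `K`: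
  ⟺ `Σ_K n_K|q_K − p_K| < ∞` — dag-n19-w2 g5's fixed-ratio letter `Σ n_K p_K` (p615382, `q = κp`) WITHOUT the ratio) · `min_sqrt_stat_order_of_bulk` (one step, `σ ≥ 1`:
  `5·10⁻⁷·min(1, Δ∕σ) ≤ min(1, √Λ) ≤ √2·min(1, Δ∕σ)`) · ★★ `summable_closedForm_iff_summable_sqrt_stat_of_bulk` ∕ ★★★ `exists_hybridNE7_caricature_iff_summable_sqrt_stat_of_bulk`
  (`σ_K ≥ 1` for all `K`: ⟺ `Σ_K √Λ_K < ∞`, `Λ_K = n_K·((q_K−p_K)²∕(p_K+q_K) + (q_K−p_K)²∕(2−p_K−q_K))` — FILE C's SUFFICIENCY letter is NECESSARY in the bulk).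

HONEST FRAMING.  [folklore] finite-sum probability ∕ real analysis on a CARICATURE (independent level-1 blocks, product Bernoulli class weights — the card's own simplification) and
[bookkeeping] over the tree's SHAPES BY NAME; NOTHING read at the record (`classSet₁₃ ∕ weightA₁₃ ∕ weightB₁₃` untouched; which regime — if any — the RECORD is in, and the values of
`(n_K, p_K, q_K)` there, stay UNDECIDED: dag-n20-w5's XG-LOCATED note stands); proves NO estimate of Bałaban's; refutes NO registered stub; nothing of Bałaban's asserted or
instantiated.  NE7 ∕ NE7b ∕ NE7c NOT PRINTED for `d = 4`, NOT proved; N19 ∕ N20 ∕ N21 NOT discharged; K3⁸ (stmt-QuantumFields-27366, skeleton v6 b4e55110ab73e679) and its aside K3⁷ OPEN, no stub claimed; counts unmoved (typed 28∕28 ·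
discharged 5∕27); no count claim.  One finite `𝕋⁴` programme at fixed `ε`, Bałaban AS PRINTED; the YM mass gap (Clay) is NOT proved by any of this — R4 closes the conditional
finite-𝕋⁴ rung `BalabanLadder.UV` only; NOT ℝ⁴, NOT OS.  No decl carries a cite tag.
-/

set_option autoImplicit false

noncomputable section

open Finset Filter
open Literature.MathematicalPhysics.QuantumFieldTheory.Balaban1983to89
open Literature.MathematicalPhysics.QuantumFieldTheory.Balaban1983to89.T4WeightBudget
open Literature.MathematicalPhysics.QuantumFieldTheory.Balaban1983to89.T4IndicatorShell
open Literature.MathematicalPhysics.QuantumFieldTheory.Balaban1983to89.T4MatchingAssembly (HybridNE7)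
open Summit.QuantumFields.BalabanUV.T4Continuum.Spine.NE7
open Summit.QuantumFields.YangMills.BalabanUVNodes.N20BlockCaricatureCountStatistic (exists_hybridNE7_caricature_iff_summable_l1_count faces_caricature_iff_summable_l1_count)
open Summit.QuantumFields.YangMills.BalabanUVNodes.N20BlockCaricatureTVOrder
open Summit.QuantumFields.YangMills.BalabanUVNodes.N20BlockCaricatureTVOrderBulk

namespace Summit.QuantumFields.YangMills.BalabanUVNodes.N20BlockCaricatureClosedForm

/-! ## §1 Summability bookkeeping [folklore] -/

section Summability

/-- **`Σ min(1, x_K) < ∞ ⟺ Σ x_K < ∞`** for `x ≥ 0` (a summable `min(1, x_K)` tends to `0`, so eventually `min(1, x_K) = x_K`). [folklore] -/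
theorem summable_min_one_iff {x : ℕ → ℝ} (hx : ∀ K, 0 ≤ x K) : Summable (fun K => min 1 (x K)) ↔ Summable x := by
  constructor
  · intro h
    refine Summable.of_norm_bounded_eventually_nat h ?_
    have ht := h.tendsto_atTop_zero
    have hev : ∀ᶠ K in atTop, min 1 (x K) < 1 := (tendsto_order.1 ht).2 1 one_pos
    filter_upwards [hev] with K hK
    rw [Real.norm_eq_abs, abs_of_nonneg (hx K)]
    rcases min_choice (1 : ℝ) (x K) with h1 | h1
    · rw [h1] at hK; exact absurd hK (lt_irrefl 1)
    · rw [h1]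
  · intro h
    exact Summable.of_nonneg_of_le (fun K => le_min zero_le_one (hx K)) (fun K => min_le_right _ _) h

/-- Two non-negative sequences of the same ORDER are summable together: `c·g ≤ f ≤ C·g`, `c > 0` ⇒ (`Σ f < ∞ ⟺ Σ g < ∞`). [folklore] -/
theorem summable_iff_of_order {f g : ℕ → ℝ} {c C : ℝ} (hc : 0 < c) (hf : ∀ K, 0 ≤ f K) (hg : ∀ K, 0 ≤ g K)
    (hlo : ∀ K, c * g K ≤ f K) (hhi : ∀ K, f K ≤ C * g K) : Summable f ↔ Summable g := by
  constructor
  · intro h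
    refine Summable.of_nonneg_of_le hg (fun K => ?_) (h.div_const c)
    rw [le_div_iff₀ hc, mul_comm]
    exact hlo K
  · intro h
    exact Summable.of_nonneg_of_le hf hhi (h.mul_left C)

end Summability

/-! ## §2 The exact criterion of the caricature in CLOSED FORM along `K` [folklore ∕ bookkeeping] -/

section ClosedForm

variable (n : ℕ → ℕ) (p q : ℕ → ℝ)

/-- ★★ **THE COUNT ℓ¹ DISTANCES ARE SUMMABLE IFF THE CLOSED FORM IS**: for `p_K, q_K ∈ [0,1]`,
`Σ_K ℓ_K < ∞ ⟺ Σ_K min(1, n_K|q_K − p_K| ∕ max(1, σ_K)) < ∞`, `σ_K = √(n_K·max(p_K(1−p_K), q_K(1−q_K)))` (FILE J `l1Count_order`: the two are of the same order). -/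
theorem summable_l1Count_iff_summable_closedForm (hp : ∀ K, 0 ≤ p K ∧ p K ≤ 1) (hq : ∀ K, 0 ≤ q K ∧ q K ≤ 1) :
    (Summable fun K => ∑ k ∈ Finset.range (n K + 1), ((n K).choose k : ℝ) * |q K ^ k * (1 - q K) ^ (n K - k) - p K ^ k * (1 - p K) ^ (n K - k)|) ↔
      Summable fun K => min 1 (n K * |q K - p K| / max 1 (Real.sqrt (n K * max (p K * (1 - p K)) (q K * (1 - q K))))) :=
  summable_iff_of_order (c := 1 / 1000000) (C := 2 * Real.sqrt 2) (by norm_num) (fun K => l1Count_nonneg (p K) (q K) (n K))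
    (fun K => le_min zero_le_one (by positivity)) (fun K => (l1Count_order (hp K).1 (hp K).2 (hq K).1 (hq K).2 (n K)).1)
    (fun K => (l1Count_order (hp K).1 (hp K).2 (hq K).1 (hq K).2 (n K)).2)

/-- ★★★★ **THE EXACT CRITERION OF K3 STUB 2's FACE TRIPLE ON THE CARICATURE, IN CLOSED FORM** [folklore ∕ bookkeeping]: for `p_K ∈ (0,1)`, `q_K ∈ [0,1]`, any `vol`, any `l₀ ≥ 0`:
SOME `(Bad, W, shA, shB, Wsh, δ)` give node U5's bundled binder list `HybridNE7` on the caricature carriers `T_K = 𝒫(range n_K)`, `A_S = p_K^{#S}(1−p_K)^{n_K−#S}`, `B_S = q_K^{#S}(1−q_K)^{n_K−#S}`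
IFF `Σ_K min(1, n_K|q_K − p_K| ∕ max(1, √(n_K·max(p_K(1−p_K), q_K(1−q_K))))) < ∞` — the summable «expected number of discrepant level-1 blocks in units of max(1, its larger
standard deviation)».  MY FILE F `exists_hybridNE7_caricature_iff_summable_l1_count` ∘ `summable_l1Count_iff_summable_closedForm`. -/
theorem exists_hybridNE7_caricature_iff_summable_closedForm (hp : ∀ K, 0 < p K ∧ p K < 1) (hq : ∀ K, 0 ≤ q K ∧ q K ≤ 1)
    {l₀ : ℝ} (hl₀ : 0 ≤ l₀) (vol : ℝ) :
    (∃ (Bad : ℕ → ℝ → Finset (Finset ℕ)) (W : ℕ → ℝ) (shA shB : ℕ → ℝ → Finset ℕ → ℝ) (Wsh δ : ℕ → ℝ),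
      HybridNE7 l₀ vol (fun K => (Finset.range (n K)).powerset) (fun K _ S => p K ^ S.card * (1 - p K) ^ (n K - S.card))
        (fun K _ S => q K ^ S.card * (1 - q K) ^ (n K - S.card)) Bad W shA shB Wsh δ) ↔
    Summable fun K => min 1 (n K * |q K - p K| / max 1 (Real.sqrt (n K * max (p K * (1 - p K)) (q K * (1 - q K))))) := by
  rw [exists_hybridNE7_caricature_iff_summable_l1_count n p q hp hq hl₀ vol]
  exact summable_l1Count_iff_summable_closedForm n p q (fun K => ⟨(hp K).1.le, (hp K).2.le⟩) hq

/-- ★★ **THE FACE-TRIPLE EDITION IN CLOSED FORM** [folklore ∕ bookkeeping]: the same for stub 2's own conjunct shape `RelWeightBound ∧ ShellWeightBound ∧ (Core ∧ Summable δ)`. -/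
theorem faces_caricature_iff_summable_closedForm (hp : ∀ K, 0 < p K ∧ p K < 1) (hq : ∀ K, 0 ≤ q K ∧ q K ≤ 1)
    {l₀ : ℝ} (hl₀ : 0 ≤ l₀) (vol : ℝ) :
    (∃ (Bad : ℕ → ℝ → Finset (Finset ℕ)) (W : ℕ → ℝ) (shA shB : ℕ → ℝ → Finset ℕ → ℝ) (Wsh δ : ℕ → ℝ),
      RelWeightBound l₀ (fun K => (Finset.range (n K)).powerset) (fun K _ S => p K ^ S.card * (1 - p K) ^ (n K - S.card))
        (fun K _ S => q K ^ S.card * (1 - q K) ^ (n K - S.card)) Bad W ∧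
      ShellWeightBound l₀ (fun K => (Finset.range (n K)).powerset) (fun K _ S => p K ^ S.card * (1 - p K) ^ (n K - S.card))
        (fun K _ S => q K ^ S.card * (1 - q K) ^ (n K - S.card)) shA shB Wsh ∧
      (Core l₀ vol (fun K => (Finset.range (n K)).powerset) Bad (fun K t S => p K ^ S.card * (1 - p K) ^ (n K - S.card) - shA K t S)
        (fun K t S => q K ^ S.card * (1 - q K) ^ (n K - S.card) - shB K t S) δ ∧ Summable δ)) ↔
    Summable fun K => min 1 (n K * |q K - p K| / max 1 (Real.sqrt (n K * max (p K * (1 - p K)) (q K * (1 - q K))))) := by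
  rw [faces_caricature_iff_summable_l1_count n p q hp hq hl₀ vol]
  exact summable_l1Count_iff_summable_closedForm n p q (fun K => ⟨(hp K).1.le, (hp K).2.le⟩) hq

end ClosedForm

/-! ## §3 The two regimes: rare blocks ⟹ the COUNT letter; bulk ⟹ CRIT-1's `√Λ` letter [folklore ∕ bookkeeping] -/

section OneStepBulk

variable {p q : ℝ}

/-- In the bulk regime at one step (`1 ≤ n·max(p(1−p), q(1−q))`), CRIT-1's `√Λ` (`Λ = n·((q−p)²∕(p+q) + (q−p)²∕(2−p−q))`) and the closed form are of the same order:
`5·10⁻⁷·min(1, Δ∕σ) ≤ min(1, √Λ) ≤ √2·min(1, Δ∕σ)` (lower: FILE I `l1Count_le_two_mul_sqrt_stat` against FILE J `l1Count_ge_order`; upper: `Λ₁ ≤ 2(q−p)²∕max-variance`). [folklore] -/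
theorem min_sqrt_stat_order_of_bulk (hp0 : 0 ≤ p) (hp1 : p ≤ 1) (hq0 : 0 ≤ q) (hq1 : q ≤ 1) {m : ℕ} (hbulk : 1 ≤ (m : ℝ) * max (p * (1 - p)) (q * (1 - q))) :
    1 / 2000000 * min 1 (m * |q - p| / Real.sqrt (m * max (p * (1 - p)) (q * (1 - q)))) ≤
        min 1 (Real.sqrt (m * ((q - p) ^ 2 / (p + q) + (q - p) ^ 2 / (2 - p - q)))) ∧
      min 1 (Real.sqrt (m * ((q - p) ^ 2 / (p + q) + (q - p) ^ 2 / (2 - p - q)))) ≤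
        Real.sqrt 2 * min 1 (m * |q - p| / Real.sqrt (m * max (p * (1 - p)) (q * (1 - q)))) := by
  set v := max (p * (1 - p)) (q * (1 - q)) with hv_def
  set σ := Real.sqrt (m * v) with hσ_def
  have hσ1 : 1 ≤ σ := Real.one_le_sqrt.2 hbulk
  have hσ0 : 0 < σ := by linarith
  have hm0 : (0 : ℝ) < m := by
    rcases (Nat.cast_nonneg m : (0 : ℝ) ≤ m).eq_or_lt with h | h
    · rw [← h, zero_mul] at hbulk; norm_num at hbulk
    · exact h
  have hv0 : 0 < v := by
    have hvnn : 0 ≤ v := le_max_of_le_left (mul_nonneg hp0 (sub_nonneg.2 hp1))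
    rcases hvnn.eq_or_lt with h | h
    · rw [← h, mul_zero] at hbulk; norm_num at hbulk
    · exact h
  have hx0 : 0 ≤ (m : ℝ) * |q - p| / σ := by positivity
  constructor
  · -- lower: √Λ ≥ ℓ/2 ≥ 5·10⁻⁷·min(1, Δ/σ)
    have hlo := l1Count_ge_order hp0 hp1 hq0 hq1 m
    rw [← hv_def, ← hσ_def, max_eq_right hσ1] at hlo
    have hhi := l1Count_le_two_mul_sqrt_stat hp0 hp1 hq0 hq1 m
    have hS0 : 0 ≤ Real.sqrt (m * ((q - p) ^ 2 / (p + q) + (q - p) ^ 2 / (2 - p - q))) := Real.sqrt_nonneg _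
    have h1 : 1 / 2000000 * min 1 ((m : ℝ) * |q - p| / σ) ≤ Real.sqrt (m * ((q - p) ^ 2 / (p + q) + (q - p) ^ 2 / (2 - p - q))) := by linarith
    have h2 : 1 / 2000000 * min 1 ((m : ℝ) * |q - p| / σ) ≤ 1 := by
      have := min_le_left (1 : ℝ) ((m : ℝ) * |q - p| / σ); linarith
    exact le_min h2 h1
  · -- upper: √Λ ≤ √2·Δ/σ
    have hstat := stat₁_le_two_mul_sq_div_maxVar hp0 hp1 hq0 hq1 hv0
    have h1 : Real.sqrt (m * ((q - p) ^ 2 / (p + q) + (q - p) ^ 2 / (2 - p - q))) ≤ Real.sqrt 2 * ((m : ℝ) * |q - p| / σ) := by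
      have h2 : Real.sqrt (m * ((q - p) ^ 2 / (p + q) + (q - p) ^ 2 / (2 - p - q))) ≤ Real.sqrt (m * (2 * (q - p) ^ 2 / v)) :=
        Real.sqrt_le_sqrt (mul_le_mul_of_nonneg_left hstat hm0.le)
      have h3 : Real.sqrt (m * (2 * (q - p) ^ 2 / v)) = Real.sqrt 2 * ((m : ℝ) * |q - p| / σ) := by
        have hR : 0 ≤ Real.sqrt 2 * ((m : ℝ) * |q - p| / σ) := by positivity
        rw [← Real.sqrt_sq hR]
        congr 1
        rw [mul_pow, div_pow, mul_pow, Real.sq_sqrt (by norm_num : (0 : ℝ) ≤ 2), hσ_def, Real.sq_sqrt (by positivity), sq_abs]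
        field_simp
      rw [h3] at h2; exact h2
    have h2 : (1 : ℝ) ≤ Real.sqrt 2 := Real.one_le_sqrt.2 (by norm_num)
    calc min 1 (Real.sqrt (m * ((q - p) ^ 2 / (p + q) + (q - p) ^ 2 / (2 - p - q)))) ≤ min 1 (Real.sqrt 2 * ((m : ℝ) * |q - p| / σ)) := min_le_min_left _ h1
      _ ≤ _ := by
          rcases le_total 1 ((m : ℝ) * |q - p| / σ) with h | h
          · rw [min_eq_left h]; exact (min_le_left _ _).trans (by nlinarith)
          · rw [min_eq_right h]; exact min_le_right _ _

end OneStepBulk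

section Regimes

variable (n : ℕ → ℕ) (p q : ℕ → ℝ)

/-- ★★ **RARE BLOCKS EVERYWHERE** (`σ_K ≤ 1` for all `K`): the closed form is «summable expected NUMBER of discrepant blocks», `Σ_K n_K|q_K − p_K| < ∞` — dag-n19-w2 g5's fixed-ratio letter
`Σ_K n_K p_K < ∞` (p615382, `q = κp`) WITHOUT the ratio; strictly between CRIT-1's `Σ Λ_K` and `Σ √Λ_K` letters there (MY FILE G's two witnesses live in this regime). -/
theorem summable_closedForm_iff_summable_meanShift_of_rare (hrare : ∀ K, (n K : ℝ) * max (p K * (1 - p K)) (q K * (1 - q K)) ≤ 1) :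
    (Summable fun K => min 1 (n K * |q K - p K| / max 1 (Real.sqrt (n K * max (p K * (1 - p K)) (q K * (1 - q K)))))) ↔
      Summable fun K => (n K : ℝ) * |q K - p K| := by
  have hσ : ∀ K, max 1 (Real.sqrt (n K * max (p K * (1 - p K)) (q K * (1 - q K)))) = 1 := fun K => max_eq_left (Real.sqrt_le_one.2 (hrare K))
  simp_rw [hσ, div_one]
  exact summable_min_one_iff fun K => by positivity

/-- ★★★ **RARE BLOCKS: THE CRITERION IS THE COUNT LETTER** [folklore ∕ bookkeeping]: `p_K ∈ (0,1)`, `q_K ∈ [0,1]`, `n_K·max(p_K(1−p_K), q_K(1−q_K)) ≤ 1` for all `K` ⇒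
(SOME dials give `HybridNE7` on the caricature) ⟺ `Σ_K n_K·|q_K − p_K| < ∞`. -/
theorem exists_hybridNE7_caricature_iff_summable_meanShift_of_rare (hp : ∀ K, 0 < p K ∧ p K < 1) (hq : ∀ K, 0 ≤ q K ∧ q K ≤ 1)
    (hrare : ∀ K, (n K : ℝ) * max (p K * (1 - p K)) (q K * (1 - q K)) ≤ 1) {l₀ : ℝ} (hl₀ : 0 ≤ l₀) (vol : ℝ) :
    (∃ (Bad : ℕ → ℝ → Finset (Finset ℕ)) (W : ℕ → ℝ) (shA shB : ℕ → ℝ → Finset ℕ → ℝ) (Wsh δ : ℕ → ℝ),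
      HybridNE7 l₀ vol (fun K => (Finset.range (n K)).powerset) (fun K _ S => p K ^ S.card * (1 - p K) ^ (n K - S.card))
        (fun K _ S => q K ^ S.card * (1 - q K) ^ (n K - S.card)) Bad W shA shB Wsh δ) ↔
    Summable fun K => (n K : ℝ) * |q K - p K| := by
  rw [exists_hybridNE7_caricature_iff_summable_closedForm n p q hp hq hl₀ vol]
  exact summable_closedForm_iff_summable_meanShift_of_rare n p q hrare

/-- ★★ **BULK EVERYWHERE** (`σ_K ≥ 1` for all `K`): the closed form is CRIT-1's SUFFICIENCY letter `Σ_K √Λ_K < ∞` (MY FILE C) — in the bulk regime that letter is also NECESSARY. -/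
theorem summable_closedForm_iff_summable_sqrt_stat_of_bulk (hp : ∀ K, 0 ≤ p K ∧ p K ≤ 1) (hq : ∀ K, 0 ≤ q K ∧ q K ≤ 1)
    (hbulk : ∀ K, 1 ≤ (n K : ℝ) * max (p K * (1 - p K)) (q K * (1 - q K))) :
    (Summable fun K => min 1 (n K * |q K - p K| / max 1 (Real.sqrt (n K * max (p K * (1 - p K)) (q K * (1 - q K)))))) ↔
      Summable fun K => Real.sqrt (n K * ((q K - p K) ^ 2 / (p K + q K) + (q K - p K) ^ 2 / (2 - p K - q K))) := by
  have hσ : ∀ K, max 1 (Real.sqrt (n K * max (p K * (1 - p K)) (q K * (1 - q K)))) = Real.sqrt (n K * max (p K * (1 - p K)) (q K * (1 - q K))) :=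
    fun K => max_eq_right (Real.one_le_sqrt.2 (hbulk K))
  simp_rw [hσ]
  rw [← summable_min_one_iff (x := fun K => Real.sqrt (n K * ((q K - p K) ^ 2 / (p K + q K) + (q K - p K) ^ 2 / (2 - p K - q K)))) fun K => Real.sqrt_nonneg _]
  refine (summable_iff_of_order (c := 1 / 2000000) (C := Real.sqrt 2) (by norm_num) (fun K => le_min zero_le_one (Real.sqrt_nonneg _))
    (fun K => le_min zero_le_one (by positivity)) (fun K => (min_sqrt_stat_order_of_bulk (hp K).1 (hp K).2 (hq K).1 (hq K).2 (hbulk K)).1)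
    (fun K => (min_sqrt_stat_order_of_bulk (hp K).1 (hp K).2 (hq K).1 (hq K).2 (hbulk K)).2)).symm

/-- ★★★ **BULK: THE CRITERION IS CRIT-1's `√Λ` LETTER** [folklore ∕ bookkeeping]: `p_K ∈ (0,1)`, `q_K ∈ [0,1]`, `1 ≤ n_K·max(p_K(1−p_K), q_K(1−q_K))` for all `K` ⇒
(SOME dials give `HybridNE7` on the caricature) ⟺ `Σ_K √Λ_K < ∞`, `Λ_K = n_K·((q_K−p_K)²∕(p_K+q_K) + (q_K−p_K)²∕(2−p_K−q_K))` (MY FILE C `exists_hybridNE7_caricature_of_summable_sqrt_stat` was the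
sufficiency half; here it is an equivalence). -/
theorem exists_hybridNE7_caricature_iff_summable_sqrt_stat_of_bulk (hp : ∀ K, 0 < p K ∧ p K < 1) (hq : ∀ K, 0 ≤ q K ∧ q K ≤ 1)
    (hbulk : ∀ K, 1 ≤ (n K : ℝ) * max (p K * (1 - p K)) (q K * (1 - q K))) {l₀ : ℝ} (hl₀ : 0 ≤ l₀) (vol : ℝ) :
    (∃ (Bad : ℕ → ℝ → Finset (Finset ℕ)) (W : ℕ → ℝ) (shA shB : ℕ → ℝ → Finset ℕ → ℝ) (Wsh δ : ℕ → ℝ),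
      HybridNE7 l₀ vol (fun K => (Finset.range (n K)).powerset) (fun K _ S => p K ^ S.card * (1 - p K) ^ (n K - S.card))
        (fun K _ S => q K ^ S.card * (1 - q K) ^ (n K - S.card)) Bad W shA shB Wsh δ) ↔
    Summable fun K => Real.sqrt (n K * ((q K - p K) ^ 2 / (p K + q K) + (q K - p K) ^ 2 / (2 - p K - q K))) := by
  rw [exists_hybridNE7_caricature_iff_summable_closedForm n p q hp hq hl₀ vol]
  exact summable_closedForm_iff_summable_sqrt_stat_of_bulk n p q (fun K => ⟨(hp K).1.le, (hp K).2.le⟩) hq hbulk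

end Regimes

end Summit.QuantumFields.YangMills.BalabanUVNodes.N20BlockCaricatureClosedForm

end
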